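import Summits.RiemannHypothesis.RiemannHypothesis.Theses.LaguerreSpeiserSplit

/-!
# Disproof of `LaguerreOnLine` — findings: NO KILL (crux-attack at birth, 2026-08-17)

Crux (stmt-RiemannHypothesis-18897, route `LaguerreSpeiserSplit`, verbatim):
`∀ t : ℝ, 0 < (Re Ξ)′(t)² − Re Ξ(t)·(Re Ξ)″(t)` — the STRICT Laguerre inequality for Riemann's `Ξ` on
the whole real axis (Csordas, arXiv:1309.0055, Open Problem 4.7 strict form; Remark 4.8).

Index of kernel-checked content (no `sorry` in this file):

* (a) LOAD-BEARING ANALYSIS — the crux has no hypotheses; nothing to drop.  Its two halves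
  (planner skeleton `Lines/birth.lean`: X2 ⟺ SLOPE ∧ SIMPLE) are recorded here as
  `simpleRealZeros_of_laguerreOnLine` (X2 ⇒ every real zero of `Ξ` simple = the simple-zeros
  conjecture for zeros ON the line; RH ⇏ this) and the trivial `laguerreAtCriticalPoints_of_laguerreOnLine`.
* (b) WHAT THE ROUTE CONSUMES — `LaguerreAtCriticalPoints` (C′: the sign `Ξ(c)Ξ″(c) < 0` at real
  critical points off the zeros) and `closes_of_criticalPoints : XiPrimeOnLine → C′ →
  LaguerreHeredityOfXiPrime → RH` (the route's `closes` re-run with X2 weakened to C′).  C′ ⟸ SLOPE ⟸ RH.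
  Reading: SIMPLE is dead weight in X = X1 ∧ X2; a planner may restate the near crux as SLOPE or C′.
* (c) NATURAL STRENGTHENING REFUTED (small model) — "real, even, entire, order ≤ 1, strict Laguerre on
  all of ℝ ⇒ only real zeros" is FALSE: `Model.F z = (1+z²)cos(πz)` satisfies the crux's inequality in
  its exact Lean shape at every real `t` (`Model.laguerreOnLine_model`, margin `≥ π² − 2`) and
  `F(i) = 0`.  So X2 ⇏ RH by LP-type function theory alone; X1 is load-bearing.  (Landing as
  `Theorems/LaguerreOnLine/Negative/LaguerreSpeiserSplitLaguerreOnLineShapeModel.lean`, p172639.)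
* (d) Targets — none yet (no line picked).
* (e) Near-misses — none.  No finite falsifier exists: off the zeros `L₁(t) > 0` for `|t| ≤ T − 1/2`
  whenever RH is verified to height `T` (Csordas Prop. 2.2; `T = 3·10¹²`, Platt–Trudgian), so a real
  `t` with `L₁(t) ≤ 0` is an RH counterexample (`Ξ(t) ≠ 0`) or a multiple zero (`Ξ(t) = 0`) above
  every verified height.  Sign convention checked at `t = 0`: `−Ξ(0)Ξ″(0) ≈ +0.0114 > 0`
  (numeric sanity scan kit j027835).
-/

noncomputable section

set_option linter.dupNamespace false

namespace Summit.RiemannHypothesis.RiemannHypothesis.Cruxes.LaguerreOnLine.Disproof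

open Summit.RiemannHypothesis.RiemannHypothesis.Theses.LaguerreSpeiserSplit
open Literature.NumberTheory.LFunctions

theorem differentiable_riemannXiUpper : Differentiable ℂ riemannXiUpper := by
  have h : riemannXiUpper = fun z => riemannXi (1 / 2 + Complex.I * z) := rfl
  rw [h]
  exact differentiable_riemannXi.comp
    ((differentiable_const _).add ((differentiable_const _).mul differentiable_id))

theorem deriv_re_riemannXiUpper (t : ℝ) :
    deriv (fun u : ℝ => (riemannXiUpper (u : ℂ)).re) t = (deriv riemannXiUpper (t : ℂ)).re :=
  (Literature.Analysis.Complex.KiKim.hasDerivAt_re_ofReal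
    (differentiable_riemannXiUpper.differentiableAt)).deriv

/-- X2 ⇒ every real zero of `Ξ` is a simple zero. -/
theorem simpleRealZeros_of_laguerreOnLine (h : LaguerreOnLine) (t : ℝ)
    (ht : riemannXiUpper (t : ℂ) = 0) : deriv riemannXiUpper (t : ℂ) ≠ 0 := by
  intro h0
  have h2 := h t
  rw [ht, deriv_re_riemannXiUpper, h0] at h2
  simp at h2

/-- C′: the Laguerre sign only at real critical points off the zeros (what `closes` consumes). -/
def LaguerreAtCriticalPoints : Prop :=
  ∀ c : ℝ, deriv (fun u : ℝ => (riemannXiUpper (u : ℂ)).re) c = 0 →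
    (riemannXiUpper (c : ℂ)).re ≠ 0 →
    (riemannXiUpper (c : ℂ)).re * iteratedDeriv 2 (fun u : ℝ => (riemannXiUpper (u : ℂ)).re) c < 0

theorem laguerreAtCriticalPoints_of_laguerreOnLine (h : LaguerreOnLine) : LaguerreAtCriticalPoints := by
  intro c hc1 _hc0
  have h2 := h c
  rw [hc1] at h2
  linarith

/-- The route's deciding theorem with X2 weakened to C′ (proof = the route's `closes`, verbatim
except the level-0 step). -/
theorem closes_of_criticalPoints (h1 : XiPrimeOnLine) (h2 : LaguerreAtCriticalPoints)
    (h3 : LaguerreHeredityOfXiPrime) : _root_.Summit.RiemannHypothesis := by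
  classical
  have hΞ : Differentiable ℂ riemannXiUpper := differentiable_riemannXiUpper
  have hX : Literature.Analysis.Complex.HasNoFourierCriticalPoint
      (fun t : ℝ => (riemannXiUpper (t : ℂ)).re) := by
    have hderiv : deriv (fun t : ℝ => (riemannXiUpper (t : ℂ)).re)
        = fun t : ℝ => (deriv riemannXiUpper (t : ℂ)).re := by
      funext t
      exact (Literature.Analysis.Complex.KiKim.hasDerivAt_re_ofReal (hΞ.differentiableAt)).deriv
    have h31 := h3 h1
    intro l c hc1 hc0
    cases l with
    | zero =>
      rw [zero_add, iteratedDeriv_one] at hc1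
      rw [iteratedDeriv_zero] at hc0 ⊢
      have h2c := h2 c hc1 hc0
      show (riemannXiUpper (c : ℂ)).re *
          iteratedDeriv (0 + 2) (fun u : ℝ => (riemannXiUpper (u : ℂ)).re) c < 0
      rw [zero_add]
      exact h2c
    | succ l =>
      have e0 : iteratedDeriv (l + 1) (fun t : ℝ => (riemannXiUpper (t : ℂ)).re) c
          = iteratedDeriv l (fun t : ℝ => (deriv riemannXiUpper (t : ℂ)).re) c := by
        rw [iteratedDeriv_succ', hderiv]
      have e1 : iteratedDeriv (l + 1 + 1) (fun t : ℝ => (riemannXiUpper (t : ℂ)).re) c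
          = iteratedDeriv (l + 1) (fun t : ℝ => (deriv riemannXiUpper (t : ℂ)).re) c := by
        rw [iteratedDeriv_succ', hderiv]
      have e2 : iteratedDeriv (l + 1 + 2) (fun t : ℝ => (riemannXiUpper (t : ℂ)).re) c
          = iteratedDeriv (l + 2) (fun t : ℝ => (deriv riemannXiUpper (t : ℂ)).re) c := by
        rw [show l + 1 + 2 = (l + 2) + 1 by ring, iteratedDeriv_succ', hderiv]
      rw [e1] at hc1
      rw [e0] at hc0 ⊢
      rw [e2]
      exact h31 l c hc1 hc0
  have hreal : ∀ z : ℂ, riemannXiUpper z = 0 → z.im = 0 := by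
    let G : ℂ → ℂ := fun w => xiSq (-w)
    have G_sq : ∀ z : ℂ, G (z ^ 2) = riemannXiUpper z := by
      intro z
      show xiSq (-(z ^ 2)) = _
      have h : -(z ^ 2) = (Complex.I * z) ^ 2 := by rw [mul_pow, Complex.I_sq]; ring
      rw [h, xiSq_sq]
      rfl
    have hGd : Differentiable ℂ G := differentiable_xiSq.comp differentiable_neg
    have G_real : ∀ x : ℝ, (G x).im = 0 := by
      intro x
      have h : (starRingEnd ℂ) (xiSq (-(x : ℂ))) = xiSq (-(x : ℂ)) := by
        rw [← xiSq_conj, map_neg, Complex.conj_ofReal]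
      exact Complex.conj_eq_iff_im.mp h
    have G_zero_ne : G 0 ≠ 0 := by
      show xiSq (-0) ≠ 0
      rw [neg_zero]
      exact xiSq_zero_ne
    have G_zero_re_ne : (G 0).re ≠ 0 := by
      intro hre
      apply G_zero_ne
      apply Complex.ext
      · simpa using hre
      · simpa using G_real 0
    obtain ⟨C, hC⟩ := norm_xiSq_le
    have G_orderLtOne : Literature.Analysis.Complex.IsEntireOfOrderLt 1 G := by
      refine ⟨hGd, 7 / 8, C, by norm_num, fun w => ?_⟩
      have h := hC (-w)
      rw [norm_neg] at h
      exact h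
    have hHγ : Literature.Analysis.Complex.HasNoFourierCriticalPoint (fun s : ℝ => (G ((s : ℂ) ^ 2)).re) := by
      have h : (fun s : ℝ => (G ((s : ℂ) ^ 2)).re) =
          fun t : ℝ => (riemannXiUpper (t : ℂ)).re := by
        funext s; rw [G_sq]
      rw [h]
      exact hX
    have hHG : Literature.Analysis.Complex.HasNoFourierCriticalPoint (fun t : ℝ => (G t).re) :=
      Literature.Analysis.Complex.KiKim.noCrit_re_of_gammaChain hGd G_real G_zero_re_ne hHγ
    intro z hz
    have hzsq : G (z ^ 2) = 0 := by rw [G_sq]; exact hz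
    have him2 : (z ^ 2).im = 0 :=
      Literature.Analysis.Complex.KiKim.im_eq_zero_of_noCrit_of_order_lt_one G_orderLtOne G_zero_ne
        G_real hHG (z ^ 2) hzsq
    have hre2 : 0 ≤ (z ^ 2).re := by
      by_contra hneg
      push Not at hneg
      have halt := Literature.Analysis.Complex.KiKim.re_iteratedDeriv_zero_mul_succ_neg hGd G_zero_re_ne hHγ
      have h1' := Literature.Analysis.Complex.KiKim.re_iteratedDeriv_ne_zero_of_neg hGd G_real halt 0 hneg
      have h2' : z ^ 2 = (((z ^ 2).re : ℝ) : ℂ) := Complex.ext (by simp) (by simpa using him2)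
      rw [h2'] at hzsq
      simp only [iteratedDeriv_zero] at h1'
      exact h1' (by rw [hzsq]; simp)
    have him : (z ^ 2).im = 2 * z.re * z.im := by simp [sq, Complex.mul_im]; ring
    have hre : (z ^ 2).re = z.re * z.re - z.im * z.im := by simp [sq, Complex.mul_re]
    rw [him] at him2
    rw [hre] at hre2
    by_contra hzim
    have hzre : z.re = 0 := by
      rcases mul_eq_zero.mp him2 with h | h
      · rcases mul_eq_zero.mp h with h' | h'
        · norm_num at h'
        · exact h'
      · exact absurd h hzim
    rw [hzre] at hre2
    have : 0 < z.im * z.im := mul_self_pos.mpr hzim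
    linarith
  exact riemannHypothesis_iff_im_eq_zero_of_riemannXiUpper_eq_zero_holds.2 hreal

/-! ### (c) The small model: the crux's SHAPE does not force real zeros -/

namespace Model

open Real

/-- the model -/
def F (z : ℂ) : ℂ := (1 + z ^ 2) * Complex.cos (Real.pi * z)

/-- its real restriction -/
def g (u : ℝ) : ℝ := (1 + u ^ 2) * Real.cos (π * u)

/-- first derivative of `g` -/
def g1 (u : ℝ) : ℝ := 2 * u * Real.cos (π * u) - π * (1 + u ^ 2) * Real.sin (π * u)

/-- second derivative of `g` -/
def g2 (u : ℝ) : ℝ :=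
  2 * Real.cos (π * u) - 4 * π * u * Real.sin (π * u) - π ^ 2 * (1 + u ^ 2) * Real.cos (π * u)

theorem F_differentiable : Differentiable ℂ F := by
  unfold F; fun_prop

theorem F_even (z : ℂ) : F (-z) = F z := by
  unfold F
  rw [mul_neg, Complex.cos_neg, neg_sq]

theorem F_ofReal (u : ℝ) : F u = (g u : ℂ) := by
  unfold F g
  push_cast
  ring

theorem F_real (u : ℝ) : (F u).im = 0 := by
  rw [F_ofReal, Complex.ofReal_im]

theorem F_re (u : ℝ) : (F u).re = g u := by
  rw [F_ofReal, Complex.ofReal_re]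

theorem F_I : F Complex.I = 0 := by
  unfold F; simp

theorem hasDerivAt_g (u : ℝ) : HasDerivAt g (g1 u) u := by
  have h1 : HasDerivAt (fun x : ℝ => 1 + x ^ 2) (2 * u) u := by
    have := (hasDerivAt_pow 2 u).const_add 1
    simpa using this
  have h2 : HasDerivAt (fun x : ℝ => π * x) π u := by
    simpa using (hasDerivAt_id u).const_mul π
  have h3 : HasDerivAt (fun x : ℝ => Real.cos (π * x)) (-Real.sin (π * u) * π) u :=
    (Real.hasDerivAt_cos (π * u)).comp u h2
  have h4 := h1.fun_mul h3
  unfold g g1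
  convert h4 using 1
  all_goals (first | rfl | ring)

theorem deriv_g : deriv g = g1 := by
  funext u
  exact (hasDerivAt_g u).deriv

theorem hasDerivAt_g1 (u : ℝ) : HasDerivAt g1 (g2 u) u := by
  have h1 : HasDerivAt (fun x : ℝ => 1 + x ^ 2) (2 * u) u := by
    have := (hasDerivAt_pow 2 u).const_add 1
    simpa using this
  have h2 : HasDerivAt (fun x : ℝ => π * x) π u := by
    simpa using (hasDerivAt_id u).const_mul π
  have h3 : HasDerivAt (fun x : ℝ => Real.cos (π * x)) (-Real.sin (π * u) * π) u :=
    (Real.hasDerivAt_cos (π * u)).comp u h2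
  have h5 : HasDerivAt (fun x : ℝ => 2 * x) 2 u := by
    simpa using (hasDerivAt_id u).const_mul (2 : ℝ)
  have h6 := h5.fun_mul h3
  have h7 : HasDerivAt (fun x : ℝ => Real.sin (π * x)) (Real.cos (π * u) * π) u :=
    (Real.hasDerivAt_sin (π * u)).comp u h2
  have h8 : HasDerivAt (fun x : ℝ => π * (1 + x ^ 2)) (π * (2 * u)) u := h1.const_mul π
  have h9 := h8.fun_mul h7
  have h10 := h6.fun_sub h9
  unfold g1 g2
  convert h10 using 1
  all_goals (first | rfl | ring)

theorem iteratedDeriv_two_g (u : ℝ) : iteratedDeriv 2 g u = g2 u := by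
  rw [show (2 : ℕ) = 1 + 1 from rfl, iteratedDeriv_succ, iteratedDeriv_one, deriv_g]
  exact (hasDerivAt_g1 u).deriv

/-- the key identity: `g′² − g g″ = π² (1 + u²)² − 2 cos²(πu) (1 − u²)`. -/
theorem laguerre_eq (u : ℝ) :
    g1 u ^ 2 - g u * g2 u = π ^ 2 * (1 + u ^ 2) ^ 2 - 2 * Real.cos (π * u) ^ 2 * (1 - u ^ 2) := by
  have h := Real.sin_sq_add_cos_sq (π * u)
  unfold g g1 g2
  linear_combination (π ^ 2 * (1 + u ^ 2) ^ 2) * h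

/-- uniform strict Laguerre inequality for the model: `g′² − g g″ ≥ π² − 2 > 0`. -/
theorem laguerre_pos (u : ℝ) : 0 < g1 u ^ 2 - g u * g2 u := by
  rw [laguerre_eq]
  have hπ : 3 < π := Real.pi_gt_three
  have hc : Real.cos (π * u) ^ 2 ≤ 1 := by
    have := Real.cos_sq_le_one (π * u)
    simpa using this
  have hc0 : 0 ≤ Real.cos (π * u) ^ 2 := sq_nonneg _
  have hu : 0 ≤ u ^ 2 := sq_nonneg _
  have hP : 9 < π ^ 2 := by nlinarith
  nlinarith [mul_nonneg hu hc0, mul_nonneg hu hu, mul_nonneg (le_of_lt (by linarith : (0:ℝ) < π ^ 2)) hu,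
    mul_nonneg (le_of_lt (by linarith : (0:ℝ) < π ^ 2)) (mul_nonneg hu hu)]

/-- The model in the exact shape of `LaguerreOnLine` (with `Ξ` replaced by `F`). -/
theorem laguerreOnLine_model :
    ∀ t : ℝ, 0 < deriv (fun u : ℝ => (F (u : ℂ)).re) t ^ 2
      - (F (t : ℂ)).re * iteratedDeriv 2 (fun u : ℝ => (F (u : ℂ)).re) t := by
  intro t
  have hfun : (fun u : ℝ => (F (u : ℂ)).re) = g := by
    funext u; exact F_re u
  rw [hfun, F_re, deriv_g, iteratedDeriv_two_g]
  exact laguerre_pos t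

/-- Summary: a real, even, entire `F` with the `LaguerreOnLine` property and a non-real zero. -/
theorem laguerreOnLine_does_not_force_real_zeros :
    ∃ F : ℂ → ℂ, Differentiable ℂ F ∧ (∀ u : ℝ, (F u).im = 0) ∧ (∀ z, F (-z) = F z) ∧
      (∀ t : ℝ, 0 < deriv (fun u : ℝ => (F (u : ℂ)).re) t ^ 2
        - (F (t : ℂ)).re * iteratedDeriv 2 (fun u : ℝ => (F (u : ℂ)).re) t) ∧
      ∃ z : ℂ, F z = 0 ∧ z.im ≠ 0 :=
  ⟨F, F_differentiable, F_real, F_even, laguerreOnLine_model, Complex.I, F_I, by simp⟩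

end Model

end Summit.RiemannHypothesis.RiemannHypothesis.Cruxes.LaguerreOnLine.Disproof

end
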